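import Summits.AtomisticToContinuum.HydrodynamicLimit.Theses.JParityClosure
import Summits.AtomisticToContinuum.HydrodynamicLimit.Theorems.DensityCap.Negative.MollifiedDensity
import Summits.AtomisticToContinuum.HydrodynamicLimit.Theorems.DensityCap.Negative.KernelMass
import Summits.AtomisticToContinuum.HydrodynamicLimit.Theorems.JParityClosureDensityCapMeanDisplacement
import Literature.Analysis.FluidPDE.HardSphereDynamicsProofs
import Literature.Analysis.FluidPDE.HardSphereRegularGeometry
import Literature.Analysis.FluidPDE.HardSphereTorusMeasure
import Literature.Analysis.FluidPDE.HardSpherePhaseSpaceProofs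
import Literature.Analysis.FluidPDE.BoltzmannGradLimit

/-!
# drefute gen-4 — line `lipschitz-clock-free-past-cap` (crux `JParityClosure.DensityCap`, stmt-AtomisticToContinuum-13082):
kernel-checked LOAD-BEARING WITNESSES for the hypotheses of STUB D and STUB E (LEAD RESHAPE v1, sha 586f0016…)

Fourth, independent pass. The four registered stubs are PROVED (A `stub_meanDisplacement` landed p76245, B
`stub_eulerDensityModulus` landed p76778, D `stub_capEventSubset` / E `stub_gridUpgrade` candidate proofs of gen-1 /
gen-2, re-verified against the current tree this session), so no stub is false or misstated. gen-3 recorded which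
hypotheses of B and E are load-bearing by theorems, and left gaps "with paper witnesses only" or "no typed
witness": `hSt` (and the two net-covering hypotheses) of D, and `hmod` of E. This file closes them (§1–§4) and adds
one positive strengthening of E (§5):

* §1 `not_capEventSubset_without_hSt` — STUB D with `hSt : ∀ s ∈ St, s ∈ Icc 0 t` DROPPED is FALSE: a time net
  poking out of `[0, t]` reads the field where nothing constrains it (`t = 0`, `St = {δt}`, `ρ(0,·) ≡ −2M−1`,
  `ρ(s,·) ≡ M/2` for `s ≠ 0`, `M = 3/(πr³)`, `η = 2M`: every good configuration overshoots at time `0`, while the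
  single grid event at time `δt` is EMPTY because `0 ≤ ρ̄ʳ ≤ M`).
* §2 `not_capEventSubset_without_hSt'` — D with the covering property of the time net dropped is FALSE (`St = ∅`).
* §3 `not_capEventSubset_without_hSx` — D with the covering property of the space net dropped is FALSE (`Sx = ∅`).
* §4 `not_gridUpgrade_without_hmod` — STUB E with the density-modulus package `hmod` DROPPED is FALSE: the
  homogeneous equilibrium data `(1,1,0)` (tied at `t = 0`, `homogeneous_lln`; flows by `flows_nonempty`; energy
  tightness by the tie; displacement = landed A) with the PUNCTURED field `ρ(s,x) = 1` for `x ≠ 0`, `ρ(s,0) = −3`: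
  the fixed-time density LLN `hlln` still holds (it only sees `∫ χ ρ(s)`, and points are Haar-null on `𝕋³`,
  `nullSingletonClass_volume_unitAddTorus`), but at `(s,x) = (0,0)` every configuration overshoots
  (`ρ̄ʳ ≥ 0 > −3 + 1`), so the overshoot event is everything, probability `1 > 1/2`. Hence SOME regularity of `ρ`
  beyond what the LLN identifies is load-bearing in E.

* §5 (POSITIVE, kernel-checked; information for re-users of E, e.g. Disproof §11's `GridUpgrade` lemma shape)
  `gridUpgrade_of_submean` / `gridUpgrade_min2` — STUB E holds with the SUB-MEAN-VALUE half (i) of `hmod` ALONE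
  (the joint modulus (ii), `ht`, `hdisp`, `r₀ ≤ 1/2` all dropped; the laws may even be junk of zero or infinite
  mass): (i) + `hlln` + the sure clock make the mollified Euler field `(s,x) ↦ ∫ cone r y x ρ(s,y) dy` Lipschitz on
  `[0,t] × 𝕋³` with the clock's constants (`hboot`: sandwich through one good configuration of the intersection of
  two high-probability LLN events, the energy event and the good set — nonempty at some `N` as soon as the masses
  do not tend to `0`; if they do, the cap is trivial), and D's bookkeeping runs on `∫ cone·ρ` instead of `ρ`.
  Consequences: (a) inside E, (i) and (ii) are each individually redundant ((ii) ⇒ (i) by cone mass `1`), but not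
  both (§4); (b) gen-3's sharpness remark `not_eulerDensityModulus_at_T` (B's modulus (ii) fails at `t = T` for a
  blow-up `ρ = (T−s)⁻¹`) is an artefact of routing through (ii): that field satisfies (i) on all of `[0, T]`
  trivially (it is constant in `x`), so through `gridUpgrade_of_submean` the only obstruction to the cap at `t = T`
  is the range of the fixed-time density LLN, not the Euler modulus.

All hypotheses named `h…` below are the skeleton's, verbatim. refuter-drefute-stmt-AtomisticToContinuum-13082-g4-0,
2026-08-16.
-/

noncomputable section

namespace DrefuteG4.Mutations

open MeasureTheory Filter Set Topology Metric
open scoped ENNReal BigOperators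
open Literature.MathematicalPhysics.KineticTheory Literature.Analysis.FluidPDE
open Summit.AtomisticToContinuum.HydrodynamicLimit.Theorems.DensityCapNegative
  (cone mollDensity capEvent CapLimit mollDensity_le mollDensity_eq mollDensity_nonneg cone_nonneg cone_le
    integral_cone coneMass coneMass_eq_one homogeneous_lln)
open Summit.AtomisticToContinuum.HydrodynamicLimit.Theorems.PolynomialCompressionPDE (Flows flows_nonempty)
open Summit.AtomisticToContinuum.HydrodynamicLimit

/-! ## §0 Shared glue (landed A as an alias; kernel glue and nets copied from gen-1/gen-3; the setting) -/

/-- The torus hard-sphere geometry in dimension `3`. -/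
abbrev G3 : Geometry (Fin 3) T3 := Torus.geometry (Fin 3)

/-- STUB A, verbatim signature — ALIAS of the landed theorem (p76245). -/
theorem stub_meanDisplacement {ε : ℝ} {n : ℕ} (Ψ : HardSphereFlow (Torus.geometry (Fin 3)) ε n)
    {z : Config n (Fin 3) T3} (hz : z ∈ Ψ.good) (s s' : ℝ) :
    (n : ℝ)⁻¹ * ∑ i, Torus.euclidDist ((Ψ.flow s' z i).1) ((Ψ.flow s z i).1) ≤
      Real.sqrt (2 * ((n : ℝ)⁻¹ * configEnergy z)) * |s' - s| :=
  Theorems.stub_meanDisplacement Ψ hz s s'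

/-- The cone kernel is symmetric. -/
theorem cone_symm (r : ℝ) (x y : T3) : cone r x y = cone r y x := by
  unfold cone
  rw [Torus.euclidDist_comm]

/-- The Haar mass of the cone kernel in the particle slot is `1` (`0 < r ≤ 1/2`). -/
theorem integral_cone_left {r : ℝ} (hr : 0 < r) (hr2 : r ≤ 1 / 2) (x : T3) : ∫ y, cone r y x = 1 := by
  simp_rw [fun y => cone_symm r y x]
  rw [integral_cone, coneMass_eq_one hr hr2]

/-- Finite `euclidDist`-nets of `𝕋³` at every mesh. -/
theorem exists_euclidDist_net {δ : ℝ} (hδ : 0 < δ) :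
    ∃ Sx : Finset T3, ∀ x : T3, ∃ x' ∈ Sx, Torus.euclidDist x x' ≤ δ := by
  have h3 : (0 : ℝ) < Real.sqrt 3 := Real.sqrt_pos.2 (by norm_num)
  obtain ⟨S, -, hSfin, hcover⟩ :=
    finite_cover_balls_of_compact (isCompact_univ (X := T3)) (e := δ / Real.sqrt 3) (by positivity)
  refine ⟨hSfin.toFinset, fun x => ?_⟩
  obtain ⟨x', hx', hxx'⟩ := Set.mem_iUnion₂.1 (hcover (Set.mem_univ x))
  refine ⟨x', hSfin.mem_toFinset.2 hx', ?_⟩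
  have hle := Torus.euclidDist_le_holds x x'
  rw [Fintype.card_fin] at hle
  have hd : ‖x - x'‖ < δ / Real.sqrt 3 := by rwa [Metric.mem_ball, dist_eq_norm] at hxx'
  calc Torus.euclidDist x x' ≤ Real.sqrt (3 : ℕ) * ‖x - x'‖ := hle
    _ ≤ Real.sqrt 3 * (δ / Real.sqrt 3) := by
        push_cast
        exact mul_le_mul_of_nonneg_left hd.le h3.le
    _ = δ := by field_simp

theorem euclidDist_triangle'' (x y w : T3) :
    Torus.euclidDist x w ≤ Torus.euclidDist x y + Torus.euclidDist y w := by
  have hproj : Literature.Analysis.FunctionSpaces.Torus.proj (Torus.reprSym (x - y) + Torus.reprSym (y - w)) =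
      x - w := by
    rw [Literature.Analysis.FunctionSpaces.Torus.proj_add, Torus.proj_reprSym, Torus.proj_reprSym]
    abel
  rw [Torus.euclidDist_eq, Torus.euclidDist_eq, Torus.euclidDist_eq]
  exact (Torus.norm_reprSym_le_of_proj_eq hproj).trans (norm_add_le _ _)

theorem cone_lipschitz_centre {r : ℝ} (hr : 0 < r) (q x x' : T3) :
    |cone r q x - cone r q x'| ≤ 3 / (Real.pi * r ^ 4) * Torus.euclidDist x x' := by
  unfold cone
  have hc : 0 ≤ 3 / (Real.pi * r ^ 3) := by positivity
  have htri : |Torus.euclidDist q x - Torus.euclidDist q x'| ≤ Torus.euclidDist x x' := by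
    rw [abs_sub_le_iff]
    constructor
    · have := euclidDist_triangle'' q x' x
      rw [Torus.euclidDist_comm x' x] at this
      linarith
    · have := euclidDist_triangle'' q x x'
      linarith
  rw [← mul_sub, abs_mul, abs_of_nonneg hc]
  calc 3 / (Real.pi * r ^ 3) * |max (1 - Torus.euclidDist q x / r) 0 - max (1 - Torus.euclidDist q x' / r) 0|
      ≤ 3 / (Real.pi * r ^ 3) * |(1 - Torus.euclidDist q x / r) - (1 - Torus.euclidDist q x' / r)| :=
        mul_le_mul_of_nonneg_left (abs_max_sub_max_le_abs _ _ _) hc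
    _ = 3 / (Real.pi * r ^ 3) * (|Torus.euclidDist q x - Torus.euclidDist q x'| / r) := by
        rw [show (1 - Torus.euclidDist q x / r) - (1 - Torus.euclidDist q x' / r) =
          -((Torus.euclidDist q x - Torus.euclidDist q x') / r) by ring, abs_neg, abs_div, abs_of_pos hr]
    _ ≤ 3 / (Real.pi * r ^ 3) * (Torus.euclidDist x x' / r) := by gcongr
    _ = 3 / (Real.pi * r ^ 4) * Torus.euclidDist x x' := by
        field_simp

theorem cone_lipschitz_particle {r : ℝ} (hr : 0 < r) (q q' x : T3) :
    |cone r q x - cone r q' x| ≤ 3 / (Real.pi * r ^ 4) * Torus.euclidDist q q' := by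
  rw [cone_symm r q x, cone_symm r q' x]
  exact cone_lipschitz_centre hr x q q'

/-- `hlip` of STUB D holds for every configuration and `r > 0`. -/
theorem mollDensity_lipschitz_centre {r : ℝ} (hr : 0 < r) {n : ℕ} (w : Config n (Fin 3) T3) (x x' : T3) :
    |mollDensity r w x - mollDensity r w x'| ≤ 3 / (Real.pi * r ^ 4) * Torus.euclidDist x x' := by
  rw [mollDensity_eq, mollDensity_eq, ← mul_sub, ← Finset.sum_sub_distrib, abs_mul,
    abs_of_nonneg (inv_nonneg.2 (Nat.cast_nonneg n))]
  rcases Nat.eq_zero_or_pos n with hn | hn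
  · subst hn
    simp only [Nat.cast_zero, inv_zero, zero_mul]
    exact mul_nonneg (by positivity) (norm_nonneg _)
  · calc (n : ℝ)⁻¹ * |∑ i, (cone r (w i).1 x - cone r (w i).1 x')|
        ≤ (n : ℝ)⁻¹ * ∑ i, |cone r (w i).1 x - cone r (w i).1 x'| := by
          gcongr
          exact Finset.abs_sum_le_sum_abs _ _
      _ ≤ (n : ℝ)⁻¹ * ∑ _i : Fin n, 3 / (Real.pi * r ^ 4) * Torus.euclidDist x x' := by
          gcongr with i _
          exact cone_lipschitz_centre hr _ _ _
      _ = 3 / (Real.pi * r ^ 4) * Torus.euclidDist x x' := by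
          rw [Finset.sum_const, Finset.card_univ, Fintype.card_fin, nsmul_eq_mul, ← mul_assoc,
            inv_mul_cancel₀ (by exact_mod_cast hn.ne'), one_mul]

theorem clock_of_meanDisplacement {r : ℝ} (hr : 0 < r) {n : ℕ} (w w' : Config n (Fin 3) T3) (x₀ : T3) {B : ℝ}
    (hdisp : (n : ℝ)⁻¹ * ∑ i, Torus.euclidDist ((w' i).1) ((w i).1) ≤ B) :
    |mollDensity r w' x₀ - mollDensity r w x₀| ≤ 3 / (Real.pi * r ^ 4) * B := by
  rw [mollDensity_eq, mollDensity_eq, ← mul_sub, ← Finset.sum_sub_distrib, abs_mul,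
    abs_of_nonneg (inv_nonneg.2 (Nat.cast_nonneg n))]
  have hc : 0 ≤ 3 / (Real.pi * r ^ 4) := by positivity
  calc (n : ℝ)⁻¹ * |∑ i, (cone r (w' i).1 x₀ - cone r (w i).1 x₀)|
      ≤ (n : ℝ)⁻¹ * ∑ i, |cone r (w' i).1 x₀ - cone r (w i).1 x₀| := by
        gcongr
        exact Finset.abs_sum_le_sum_abs _ _
    _ ≤ (n : ℝ)⁻¹ * ∑ i, 3 / (Real.pi * r ^ 4) * Torus.euclidDist (w' i).1 (w i).1 := by
        gcongr with i _
        exact cone_lipschitz_particle hr _ _ _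
    _ = 3 / (Real.pi * r ^ 4) * ((n : ℝ)⁻¹ * ∑ i, Torus.euclidDist (w' i).1 (w i).1) := by
        rw [← Finset.mul_sum]
        ring
    _ ≤ 3 / (Real.pi * r ^ 4) * B := mul_le_mul_of_nonneg_left hdisp hc

/-- `hclock` of STUB D holds for every hard-sphere flow and `r > 0` (landed A + kernel glue). -/
theorem hclock_holds {ε : ℝ} {n : ℕ} (Ψ : HardSphereFlow (Torus.geometry (Fin 3)) ε n) {r : ℝ} (hr : 0 < r) :
    ∀ z ∈ Ψ.good, ∀ (s s' : ℝ) (x₀ : T3),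
      |mollDensity r (Ψ.flow s' z) x₀ - mollDensity r (Ψ.flow s z) x₀| ≤
        3 / (Real.pi * r ^ 4) * Real.sqrt (2 * ((n : ℝ)⁻¹ * configEnergy z)) * |s' - s| := by
  intro z hz s s' x₀
  simpa only [mul_assoc] using
    clock_of_meanDisplacement hr (Ψ.flow s z) (Ψ.flow s' z) x₀ (stub_meanDisplacement Ψ hz s s')

/-- The bad set of a flow is null for the local Gibbs law (skeleton §2, copied). -/
theorem localGibbsLaw_compl_good (σ : ℝ) (a₀ θ₀ : T3 → ℝ) (u₀ : T3 → V3) (N : ℕ)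
    (Ψ : HardSphereFlow G3 (hsDiameter σ N) (N + 1)) :
    localGibbsLaw σ a₀ u₀ θ₀ N Ψ Ψ.goodᶜ = 0 := by
  have hL : localGibbsLaw σ a₀ u₀ θ₀ N Ψ =
      (liouville G3 (N + 1) (hsDiameter σ N)).withDensity fun z => ENNReal.ofReal
        (canonicalDensity G3 (hsDiameter σ N) (N + 1) (localGibbsProfile a₀ u₀ θ₀) z) := rfl
  rw [hL]
  exact withDensity_absolutelyContinuous _ _ Ψ.measure_compl_good

/-- Kinetic energy per particle (skeleton §0, copied). -/
def kinEnergy {n : ℕ} (w : Config n (Fin 3) T3) : ℝ :=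
  (n : ℝ)⁻¹ * configEnergy w

theorem kinEnergy_eq_empiricalEnergyField {n : ℕ} (w : Config n (Fin 3) T3) :
    kinEnergy w = empiricalEnergyField w (fun _ => 1) := by
  unfold kinEnergy empiricalEnergyField configEnergy
  rw [integral_empiricalMeasure]
  congr 1
  rw [Finset.mul_sum]
  refine Finset.sum_congr rfl fun i _ => ?_
  ring

/-- Energy tightness from the tie (skeleton §2, copied). -/
theorem energyTight_of_tie {σ : ℝ} {a₀ θ₀ : T3 → ℝ} {u₀ : T3 → V3} {ρ θ : ℝ → T3 → ℝ} {u : ℝ → T3 → V3}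
    (Φ : Flows σ) (h0 : TendstoHydroFieldsAt (fun N => localGibbsLaw σ a₀ u₀ θ₀ N (Φ N)) Φ ρ u θ 0) :
    Tendsto (fun N => localGibbsLaw σ a₀ u₀ θ₀ N (Φ N)
      {z | (∫ x, totalEnergyDensity (ρ 0 x) (u 0 x) (θ 0 x)) + 1 < kinEnergy z}) atTop (𝓝 0) := by
  set E₀ : ℝ := ∫ x, totalEnergyDensity (ρ 0 x) (u 0 x) (θ 0 x) with hE₀
  have h := (h0 (fun _ => (1 : ℝ)) continuous_const 1 one_pos).2.2
  have hE : (∫ x, (fun _ : T3 => (1 : ℝ)) x * totalEnergyDensity (ρ 0 x) (u 0 x) (θ 0 x)) = E₀ := by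
    simp only [one_mul, hE₀]
  refine tendsto_of_tendsto_of_tendsto_of_le_of_le tendsto_const_nhds h (fun _ => zero_le) fun N => ?_
  set P := localGibbsLaw σ a₀ u₀ θ₀ N (Φ N) with hP
  have hsub : {z : Config (N + 1) (Fin 3) T3 | E₀ + 1 < kinEnergy z} ⊆
      ({z | E₀ + 1 < kinEnergy z} ∩ (Φ N).good) ∪ (Φ N).goodᶜ := by
    intro z hz
    by_cases hg : z ∈ (Φ N).good
    · exact Or.inl ⟨hz, hg⟩
    · exact Or.inr hg
  have hincl : {z : Config (N + 1) (Fin 3) T3 | E₀ + 1 < kinEnergy z} ∩ (Φ N).good ⊆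
      {z | (1 : ℝ) < |empiricalEnergyField ((Φ N).flow 0 z) (fun _ => (1 : ℝ)) -
        ∫ x, (fun _ : T3 => (1 : ℝ)) x * totalEnergyDensity (ρ 0 x) (u 0 x) (θ 0 x)|} := by
    rintro z ⟨hz, hg⟩
    have hz' : E₀ + 1 < kinEnergy z := hz
    show (1 : ℝ) < |empiricalEnergyField ((Φ N).flow 0 z) (fun _ => (1 : ℝ)) -
        ∫ x, (fun _ : T3 => (1 : ℝ)) x * totalEnergyDensity (ρ 0 x) (u 0 x) (θ 0 x)|
    rw [(Φ N).flow_zero z hg, ← kinEnergy_eq_empiricalEnergyField, hE]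
    exact lt_of_lt_of_le (by linarith) (le_abs_self _)
  calc P {z | E₀ + 1 < kinEnergy z}
      ≤ P ({z | E₀ + 1 < kinEnergy z} ∩ (Φ N).good) + P (Φ N).goodᶜ :=
        (measure_mono hsub).trans (measure_union_le _ _)
    _ ≤ P {z | (1 : ℝ) < |empiricalEnergyField ((Φ N).flow 0 z) (fun _ => (1 : ℝ)) -
          ∫ x, (fun _ : T3 => (1 : ℝ)) x * totalEnergyDensity (ρ 0 x) (u 0 x) (θ 0 x)|} + 0 :=
        add_le_add (measure_mono hincl) (le_of_eq (localGibbsLaw_compl_good σ a₀ θ₀ u₀ N (Φ N)))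
    _ = _ := add_zero _

/-- **The setting of every witness below**: a reduced density `σ`, a flow family `Φ`, and the homogeneous local
Gibbs laws `(a₀,u₀,θ₀) = (1,0,1)`, which are probability measures TIED at `t = 0` to the constant state `(1,0,1)`
(`homogeneous_lln`, `flows_nonempty`). -/
theorem exists_setting : ∃ σ : ℝ, 0 < σ ∧ ∃ Φ : Flows σ,
    (∀ N, IsProbabilityMeasure (localGibbsLaw σ (fun _ => 1) (fun _ => 0) (fun _ => 1) N (Φ N))) ∧
    TendstoHydroFieldsAt (fun N => localGibbsLaw σ (fun _ => 1) (fun _ => 0) (fun _ => 1) N (Φ N)) Φ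
      (fun _ _ => 1) (fun _ _ => 0) (fun _ _ => 1) 0 := by
  obtain ⟨σ₁, hσ₁, hσ₁2, H⟩ := homogeneous_lln
  have hσ : (0 : ℝ) < σ₁ / 2 := by positivity
  have hσlt : σ₁ / 2 < σ₁ := by linarith
  have hσ2 : σ₁ / 2 < 1 / 2 := by linarith
  obtain ⟨Φ⟩ := flows_nonempty hσ hσ2
  exact ⟨σ₁ / 2, hσ, Φ, H (σ₁ / 2) hσ hσlt Φ⟩

/-- Under a probability law that does not charge the bad set, the good set is nonempty. -/
theorem good_nonempty {σ : ℝ} (a₀ θ₀ : T3 → ℝ) (u₀ : T3 → V3) (N : ℕ) (Φ : Flows σ)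
    [IsProbabilityMeasure (localGibbsLaw σ a₀ u₀ θ₀ N (Φ N))] : ((Φ N).good).Nonempty := by
  by_contra h
  have h0 := localGibbsLaw_compl_good σ a₀ θ₀ u₀ N (Φ N)
  rw [Set.not_nonempty_iff_eq_empty.1 h, Set.compl_empty, measure_univ] at h0
  exact one_ne_zero h0

/-! ## §1 STUB D without `hSt` (the time net inside `[0, t]`) is FALSE -/

/-- STUB D `stub_capEventSubset` with the hypothesis `hSt : ∀ s ∈ St, s ∈ Icc 0 t` DROPPED (all else verbatim). -/
def CapEventSubsetWithoutHSt : Prop :=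
  ∀ (ε : ℝ) (n : ℕ) (Ψ : HardSphereFlow (Torus.geometry (Fin 3)) ε n) (ρ : ℝ → T3 → ℝ)
    (t η r r₀ τ₀ K δx δt : ℝ), 0 < r →
    (∀ z ∈ Ψ.good, ∀ (s s' : ℝ) (x₀ : T3),
      |mollDensity r (Ψ.flow s' z) x₀ - mollDensity r (Ψ.flow s z) x₀| ≤
        3 / (Real.pi * r ^ 4) * Real.sqrt (2 * ((n : ℝ)⁻¹ * configEnergy z)) * |s' - s|) →
    (∀ (w : Config n (Fin 3) T3) (x x' : T3),
      |mollDensity r w x - mollDensity r w x'| ≤ 3 / (Real.pi * r ^ 4) * Torus.euclidDist x x') →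
    (∀ s ∈ Icc 0 t, ∀ x : T3, ∫ y, cone r y x * ρ s y ≤ ρ s x + η / 4) →
    (∀ s ∈ Icc 0 t, ∀ s' ∈ Icc 0 t, |s - s'| ≤ τ₀ →
      ∀ x x' : T3, Torus.euclidDist x x' ≤ r₀ → |ρ s x - ρ s' x'| ≤ η / 4) →
    ∀ Sx : Finset T3, (∀ x : T3, ∃ x' ∈ Sx, Torus.euclidDist x x' ≤ δx) →
    δx ≤ r₀ → 3 / (Real.pi * r ^ 4) * δx ≤ η / 8 →
    ∀ St : Finset ℝ, (∀ s ∈ Icc 0 t, ∃ s' ∈ St, |s - s'| ≤ δt) →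
    δt ≤ τ₀ → 3 / (Real.pi * r ^ 4) * Real.sqrt (2 * K) * δt ≤ η / 8 →
    {z | ∃ s ∈ Icc 0 t, ∃ x : T3, ρ s x + η < mollDensity r (Ψ.flow s z) x} ∩ Ψ.good ∩
        {z | (n : ℝ)⁻¹ * configEnergy z ≤ K} ⊆
      ⋃ s ∈ St, ⋃ x ∈ Sx, {z | η / 4 < |empiricalDensityField (Ψ.flow s z) (fun y => cone r y x) -
        ∫ y, cone r y x * ρ s y|}

/-- Sanity: the registered STUB D is `CapEventSubsetWithoutHSt` plus `hSt` (so the mutation drops exactly `hSt`). -/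
example (h : CapEventSubsetWithoutHSt) {ε : ℝ} {n : ℕ} (Ψ : HardSphereFlow (Torus.geometry (Fin 3)) ε n)
    (ρ : ℝ → T3 → ℝ) {t η r r₀ τ₀ K δx δt : ℝ} (hr : 0 < r)
    (hclock : ∀ z ∈ Ψ.good, ∀ (s s' : ℝ) (x₀ : T3),
      |mollDensity r (Ψ.flow s' z) x₀ - mollDensity r (Ψ.flow s z) x₀| ≤
        3 / (Real.pi * r ^ 4) * Real.sqrt (2 * ((n : ℝ)⁻¹ * configEnergy z)) * |s' - s|)
    (hlip : ∀ (w : Config n (Fin 3) T3) (x x' : T3),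
      |mollDensity r w x - mollDensity r w x'| ≤ 3 / (Real.pi * r ^ 4) * Torus.euclidDist x x')
    (hmod1 : ∀ s ∈ Icc 0 t, ∀ x : T3, ∫ y, cone r y x * ρ s y ≤ ρ s x + η / 4)
    (hmod2 : ∀ s ∈ Icc 0 t, ∀ s' ∈ Icc 0 t, |s - s'| ≤ τ₀ →
      ∀ x x' : T3, Torus.euclidDist x x' ≤ r₀ → |ρ s x - ρ s' x'| ≤ η / 4)
    (Sx : Finset T3) (hSx : ∀ x : T3, ∃ x' ∈ Sx, Torus.euclidDist x x' ≤ δx)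
    (hδx₁ : δx ≤ r₀) (hδx₂ : 3 / (Real.pi * r ^ 4) * δx ≤ η / 8)
    (St : Finset ℝ) (_hSt : ∀ s ∈ St, s ∈ Icc 0 t) (hSt' : ∀ s ∈ Icc 0 t, ∃ s' ∈ St, |s - s'| ≤ δt)
    (hδt₁ : δt ≤ τ₀) (hδt₂ : 3 / (Real.pi * r ^ 4) * Real.sqrt (2 * K) * δt ≤ η / 8) :
    {z | ∃ s ∈ Icc 0 t, ∃ x : T3, ρ s x + η < mollDensity r (Ψ.flow s z) x} ∩ Ψ.good ∩
        {z | (n : ℝ)⁻¹ * configEnergy z ≤ K} ⊆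
      ⋃ s ∈ St, ⋃ x ∈ Sx, {z | η / 4 < |empiricalDensityField (Ψ.flow s z) (fun y => cone r y x) -
        ∫ y, cone r y x * ρ s y|} :=
  h ε n Ψ ρ t η r r₀ τ₀ K δx δt hr hclock hlip hmod1 hmod2 Sx hSx hδx₁ hδx₂ St hSt' hδt₁ hδt₂

/-- **STUB D without `hSt` is FALSE.** Witness: the setting of `exists_setting` at `N = 0`, `t = 0`, `r = 1/4`,
`M = 3/(πr³)`, `η = 2M`, the field `ρ(0,·) ≡ −2M−1`, `ρ(s,·) ≡ M/2` (`s ≠ 0`), the time net `St = {δt}` (mesh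
`δt > 0`, OUTSIDE `[0,0]`), any `r/4`-net `Sx`, `K` = the energy of a good configuration `z₀`. All kept
hypotheses hold (`hclock`, `hlip` are theorems; `hmod1`, `hmod2` only see `s = 0`), `z₀` overshoots at `(0, x)`
for every `x` (`ρ̄ʳ ≥ 0 > −1`), but every grid event reads time `δt`, where `|ρ̄ʳ − M/2| ≤ M/2 = η/4`: EMPTY. -/
theorem not_capEventSubset_without_hSt : ¬ CapEventSubsetWithoutHSt := by
  intro h
  obtain ⟨σ, _hσ, Φ, hP, -⟩ := exists_setting
  haveI := hP 0
  obtain ⟨z₀, hz₀⟩ := good_nonempty (fun _ => (1 : ℝ)) (fun _ => (1 : ℝ)) (fun _ => (0 : V3)) 0 Φ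
  -- constants
  obtain ⟨r, hr_def⟩ : ∃ r : ℝ, r = 1 / 4 := ⟨_, rfl⟩
  have hr : (0 : ℝ) < r := by rw [hr_def]; norm_num
  have hr2 : r ≤ 1 / 2 := by rw [hr_def]; norm_num
  obtain ⟨M, hM⟩ : ∃ M : ℝ, M = 3 / (Real.pi * r ^ 3) := ⟨_, rfl⟩
  have hMpos : 0 < M := by rw [hM]; positivity
  obtain ⟨L, hL⟩ : ∃ L : ℝ, L = 3 / (Real.pi * r ^ 4) := ⟨_, rfl⟩
  have hLpos : 0 < L := by rw [hL]; positivity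
  have hLM : L * r = M := by
    rw [hL, hM]
    field_simp
  obtain ⟨K, hK⟩ : ∃ K : ℝ, K = ((0 + 1 : ℕ) : ℝ)⁻¹ * configEnergy z₀ := ⟨_, rfl⟩
  obtain ⟨A, hA⟩ : ∃ A : ℝ, A = L * Real.sqrt (2 * K) := ⟨_, rfl⟩
  have hA0 : 0 ≤ A := by rw [hA]; positivity
  obtain ⟨δt, hδt⟩ : ∃ δt : ℝ, δt = 2 * M / 8 / (A + 1) := ⟨_, rfl⟩
  have hδt_pos : 0 < δt := by rw [hδt]; positivity
  have hδx_pos : 0 < r / 4 := by positivity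
  obtain ⟨Sx, hSx⟩ := exists_euclidDist_net hδx_pos
  -- the field: `−2M−1` at time `0`, `M/2` at every other time
  obtain ⟨ρ, hρ⟩ : ∃ ρ : ℝ → T3 → ℝ, ρ = fun s _ => if s = 0 then -(2 * M) - 1 else M / 2 := ⟨_, rfl⟩
  have hρ0 : ∀ x : T3, ρ 0 x = -(2 * M) - 1 := fun x => by rw [hρ]; simp
  have hρ1 : ∀ s : ℝ, s ≠ 0 → ∀ x : T3, ρ s x = M / 2 := fun s hs x => by rw [hρ]; simp [hs]
  have hIcc : ∀ s ∈ Icc (0 : ℝ) 0, s = 0 := fun s hs => le_antisymm hs.2 hs.1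
  have hmod1 : ∀ s ∈ Icc (0 : ℝ) 0, ∀ x : T3, ∫ y, cone r y x * ρ s y ≤ ρ s x + 2 * M / 4 := by
    intro s hs x
    rw [hIcc s hs]
    simp_rw [hρ0]
    rw [integral_mul_const, integral_cone_left hr hr2 x, one_mul]
    linarith
  have hmod2 : ∀ s ∈ Icc (0 : ℝ) 0, ∀ s' ∈ Icc (0 : ℝ) 0, |s - s'| ≤ δt →
      ∀ x x' : T3, Torus.euclidDist x x' ≤ 1 → |ρ s x - ρ s' x'| ≤ 2 * M / 4 := by
    intro s hs s' hs' _ x x' _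
    rw [hIcc s hs, hIcc s' hs', hρ0, hρ0, sub_self, abs_zero]
    positivity
  have hδx1 : r / 4 ≤ 1 := by rw [hr_def]; norm_num
  have hδx2 : 3 / (Real.pi * r ^ 4) * (r / 4) ≤ 2 * M / 8 := by
    rw [← hL, ← hLM]
    linarith
  have hSt' : ∀ s ∈ Icc (0 : ℝ) 0, ∃ s' ∈ ({δt} : Finset ℝ), |s - s'| ≤ δt := by
    intro s hs
    refine ⟨δt, Finset.mem_singleton_self _, ?_⟩
    rw [hIcc s hs, zero_sub, abs_neg, abs_of_pos hδt_pos]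
  have hδt2 : 3 / (Real.pi * r ^ 4) * Real.sqrt (2 * K) * δt ≤ 2 * M / 8 := by
    rw [← hL, ← hA, hδt, mul_div_assoc', div_le_iff₀ (by positivity : (0 : ℝ) < A + 1)]
    nlinarith [hA0, hMpos.le]
  have key := h _ _ (Φ 0) ρ 0 (2 * M) r 1 δt K (r / 4) δt hr (hclock_holds (Φ 0) hr)
    (mollDensity_lipschitz_centre hr) hmod1 hmod2 Sx hSx hδx1 hδx2 {δt} hSt' le_rfl hδt2
  -- `z₀` lies in the left-hand side …
  have hz₀mem : z₀ ∈ {z | ∃ s ∈ Icc (0 : ℝ) 0, ∃ x : T3, ρ s x + 2 * M < mollDensity r ((Φ 0).flow s z) x} ∩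
      (Φ 0).good ∩ {z | ((0 + 1 : ℕ) : ℝ)⁻¹ * configEnergy z ≤ K} := by
    refine ⟨⟨⟨0, ⟨le_rfl, le_rfl⟩, 0, ?_⟩, hz₀⟩, ?_⟩
    · show ρ 0 0 + 2 * M < mollDensity r ((Φ 0).flow 0 z₀) 0
      rw [hρ0]
      have := mollDensity_nonneg hr ((Φ 0).flow 0 z₀) 0
      linarith
    · show ((0 + 1 : ℕ) : ℝ)⁻¹ * configEnergy z₀ ≤ K
      rw [hK]
  -- … but in none of the grid events, which all read time `δt ∉ [0, 0]`
  have hz₀in := key hz₀mem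
  simp only [Set.mem_iUnion, Set.mem_setOf_eq, exists_prop, Finset.mem_singleton] at hz₀in
  obtain ⟨s, hs, x, -, hdev⟩ := hz₀in
  have hρδ : ∀ y : T3, ρ s y = M / 2 := hρ1 s (by rw [hs]; exact hδt_pos.ne')
  simp_rw [hρδ] at hdev
  rw [integral_mul_const, integral_cone_left hr hr2 x, one_mul] at hdev
  have hed : empiricalDensityField ((Φ 0).flow s z₀) (fun y => cone r y x) = mollDensity r ((Φ 0).flow s z₀) x :=
    rfl
  rw [hed] at hdev
  have h0 := mollDensity_nonneg hr ((Φ 0).flow s z₀) x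
  have h1 := mollDensity_le hr ((Φ 0).flow s z₀) x
  rw [← hM] at h1
  have habs : |mollDensity r ((Φ 0).flow s z₀) x - M / 2| ≤ M / 2 := by
    rw [abs_le]
    constructor <;> linarith
  linarith

/-! ## §2 STUB D without `hSt'` (the time net COVERS `[0, t]`) is FALSE -/

/-- STUB D with the hypothesis `hSt' : ∀ s ∈ Icc 0 t, ∃ s' ∈ St, |s - s'| ≤ δt` DROPPED (all else verbatim). -/
def CapEventSubsetWithoutHSt' : Prop :=
  ∀ (ε : ℝ) (n : ℕ) (Ψ : HardSphereFlow (Torus.geometry (Fin 3)) ε n) (ρ : ℝ → T3 → ℝ)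
    (t η r r₀ τ₀ K δx δt : ℝ), 0 < r →
    (∀ z ∈ Ψ.good, ∀ (s s' : ℝ) (x₀ : T3),
      |mollDensity r (Ψ.flow s' z) x₀ - mollDensity r (Ψ.flow s z) x₀| ≤
        3 / (Real.pi * r ^ 4) * Real.sqrt (2 * ((n : ℝ)⁻¹ * configEnergy z)) * |s' - s|) →
    (∀ (w : Config n (Fin 3) T3) (x x' : T3),
      |mollDensity r w x - mollDensity r w x'| ≤ 3 / (Real.pi * r ^ 4) * Torus.euclidDist x x') →
    (∀ s ∈ Icc 0 t, ∀ x : T3, ∫ y, cone r y x * ρ s y ≤ ρ s x + η / 4) →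
    (∀ s ∈ Icc 0 t, ∀ s' ∈ Icc 0 t, |s - s'| ≤ τ₀ →
      ∀ x x' : T3, Torus.euclidDist x x' ≤ r₀ → |ρ s x - ρ s' x'| ≤ η / 4) →
    ∀ Sx : Finset T3, (∀ x : T3, ∃ x' ∈ Sx, Torus.euclidDist x x' ≤ δx) →
    δx ≤ r₀ → 3 / (Real.pi * r ^ 4) * δx ≤ η / 8 →
    ∀ St : Finset ℝ, (∀ s ∈ St, s ∈ Icc 0 t) →
    δt ≤ τ₀ → 3 / (Real.pi * r ^ 4) * Real.sqrt (2 * K) * δt ≤ η / 8 →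
    {z | ∃ s ∈ Icc 0 t, ∃ x : T3, ρ s x + η < mollDensity r (Ψ.flow s z) x} ∩ Ψ.good ∩
        {z | (n : ℝ)⁻¹ * configEnergy z ≤ K} ⊆
      ⋃ s ∈ St, ⋃ x ∈ Sx, {z | η / 4 < |empiricalDensityField (Ψ.flow s z) (fun y => cone r y x) -
        ∫ y, cone r y x * ρ s y|}

/-- **STUB D without `hSt'` is FALSE**: `St = ∅` makes the right-hand side empty while a good configuration
overshoots the constant field `ρ ≡ −2` at level `η = 1` (`t = 0`, `r = 1/4`, `δt = 0`, `Sx` a fine net). -/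
theorem not_capEventSubset_without_hSt' : ¬ CapEventSubsetWithoutHSt' := by
  intro h
  obtain ⟨σ, _hσ, Φ, hP, -⟩ := exists_setting
  haveI := hP 0
  obtain ⟨z₀, hz₀⟩ := good_nonempty (fun _ => (1 : ℝ)) (fun _ => (1 : ℝ)) (fun _ => (0 : V3)) 0 Φ
  obtain ⟨r, hr_def⟩ : ∃ r : ℝ, r = 1 / 4 := ⟨_, rfl⟩
  have hr : (0 : ℝ) < r := by rw [hr_def]; norm_num
  have hr2 : r ≤ 1 / 2 := by rw [hr_def]; norm_num
  obtain ⟨L, hL⟩ : ∃ L : ℝ, L = 3 / (Real.pi * r ^ 4) := ⟨_, rfl⟩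
  have hLpos : 0 < L := by rw [hL]; positivity
  obtain ⟨K, hK⟩ : ∃ K : ℝ, K = ((0 + 1 : ℕ) : ℝ)⁻¹ * configEnergy z₀ := ⟨_, rfl⟩
  have hδx_pos : 0 < 1 / 8 / L := by positivity
  obtain ⟨Sx, hSx⟩ := exists_euclidDist_net hδx_pos
  have hmod1 : ∀ s ∈ Icc (0 : ℝ) 0, ∀ x : T3,
      ∫ y, cone r y x * (fun (_ : ℝ) (_ : T3) => (-2 : ℝ)) s y ≤ (fun (_ : ℝ) (_ : T3) => (-2 : ℝ)) s x + 1 / 4 := by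
    intro s _ x
    show ∫ y, cone r y x * (-2 : ℝ) ≤ -2 + 1 / 4
    rw [integral_mul_const, integral_cone_left hr hr2 x, one_mul]
    norm_num
  have hmod2 : ∀ s ∈ Icc (0 : ℝ) 0, ∀ s' ∈ Icc (0 : ℝ) 0, |s - s'| ≤ 1 →
      ∀ x x' : T3, Torus.euclidDist x x' ≤ 1 / 8 / L →
        |(fun (_ : ℝ) (_ : T3) => (-2 : ℝ)) s x - (fun (_ : ℝ) (_ : T3) => (-2 : ℝ)) s' x'| ≤ 1 / 4 := by
    intro s _ s' _ _ x x' _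
    norm_num
  have hδx2 : 3 / (Real.pi * r ^ 4) * (1 / 8 / L) ≤ 1 / 8 := by
    rw [← hL, mul_div_assoc', mul_one_div, div_le_iff₀ hLpos]
    linarith
  have hSt : ∀ s ∈ (∅ : Finset ℝ), s ∈ Icc (0 : ℝ) 0 := fun s hs => absurd hs (Finset.notMem_empty s)
  have hδt2 : 3 / (Real.pi * r ^ 4) * Real.sqrt (2 * K) * 0 ≤ 1 / 8 := by norm_num
  have key := h _ _ (Φ 0) (fun _ _ => -2) 0 1 r (1 / 8 / L) 1 K (1 / 8 / L) 0 hr (hclock_holds (Φ 0) hr)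
    (mollDensity_lipschitz_centre hr) hmod1 hmod2 Sx hSx le_rfl hδx2 ∅ hSt zero_le_one hδt2
  have hz₀mem : z₀ ∈ {z | ∃ s ∈ Icc (0 : ℝ) 0, ∃ x : T3,
      (fun (_ : ℝ) (_ : T3) => (-2 : ℝ)) s x + 1 < mollDensity r ((Φ 0).flow s z) x} ∩
      (Φ 0).good ∩ {z | ((0 + 1 : ℕ) : ℝ)⁻¹ * configEnergy z ≤ K} := by
    refine ⟨⟨⟨0, ⟨le_rfl, le_rfl⟩, 0, ?_⟩, hz₀⟩, ?_⟩
    · show (-2 : ℝ) + 1 < mollDensity r ((Φ 0).flow 0 z₀) 0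
      have := mollDensity_nonneg hr ((Φ 0).flow 0 z₀) 0
      linarith
    · show ((0 + 1 : ℕ) : ℝ)⁻¹ * configEnergy z₀ ≤ K
      rw [hK]
  have hz₀in := key hz₀mem
  simp only [Set.mem_iUnion, exists_prop, Finset.notMem_empty, false_and, exists_false] at hz₀in

/-! ## §3 STUB D without `hSx` (the space net COVERS `𝕋³`) is FALSE -/

/-- STUB D with the hypothesis `hSx : ∀ x, ∃ x' ∈ Sx, Torus.euclidDist x x' ≤ δx` DROPPED (all else verbatim). -/
def CapEventSubsetWithoutHSx : Prop :=
  ∀ (ε : ℝ) (n : ℕ) (Ψ : HardSphereFlow (Torus.geometry (Fin 3)) ε n) (ρ : ℝ → T3 → ℝ)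
    (t η r r₀ τ₀ K δx δt : ℝ), 0 < r →
    (∀ z ∈ Ψ.good, ∀ (s s' : ℝ) (x₀ : T3),
      |mollDensity r (Ψ.flow s' z) x₀ - mollDensity r (Ψ.flow s z) x₀| ≤
        3 / (Real.pi * r ^ 4) * Real.sqrt (2 * ((n : ℝ)⁻¹ * configEnergy z)) * |s' - s|) →
    (∀ (w : Config n (Fin 3) T3) (x x' : T3),
      |mollDensity r w x - mollDensity r w x'| ≤ 3 / (Real.pi * r ^ 4) * Torus.euclidDist x x') →
    (∀ s ∈ Icc 0 t, ∀ x : T3, ∫ y, cone r y x * ρ s y ≤ ρ s x + η / 4) →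
    (∀ s ∈ Icc 0 t, ∀ s' ∈ Icc 0 t, |s - s'| ≤ τ₀ →
      ∀ x x' : T3, Torus.euclidDist x x' ≤ r₀ → |ρ s x - ρ s' x'| ≤ η / 4) →
    ∀ Sx : Finset T3,
    δx ≤ r₀ → 3 / (Real.pi * r ^ 4) * δx ≤ η / 8 →
    ∀ St : Finset ℝ, (∀ s ∈ St, s ∈ Icc 0 t) → (∀ s ∈ Icc 0 t, ∃ s' ∈ St, |s - s'| ≤ δt) →
    δt ≤ τ₀ → 3 / (Real.pi * r ^ 4) * Real.sqrt (2 * K) * δt ≤ η / 8 →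
    {z | ∃ s ∈ Icc 0 t, ∃ x : T3, ρ s x + η < mollDensity r (Ψ.flow s z) x} ∩ Ψ.good ∩
        {z | (n : ℝ)⁻¹ * configEnergy z ≤ K} ⊆
      ⋃ s ∈ St, ⋃ x ∈ Sx, {z | η / 4 < |empiricalDensityField (Ψ.flow s z) (fun y => cone r y x) -
        ∫ y, cone r y x * ρ s y|}

/-- **STUB D without `hSx` is FALSE**: `Sx = ∅` makes the right-hand side empty while a good configuration
overshoots `ρ ≡ −2` at level `η = 1` (`t = 0`, `r = 1/4`, `St = {0}`, `δx = δt = 0`). -/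
theorem not_capEventSubset_without_hSx : ¬ CapEventSubsetWithoutHSx := by
  intro h
  obtain ⟨σ, _hσ, Φ, hP, -⟩ := exists_setting
  haveI := hP 0
  obtain ⟨z₀, hz₀⟩ := good_nonempty (fun _ => (1 : ℝ)) (fun _ => (1 : ℝ)) (fun _ => (0 : V3)) 0 Φ
  obtain ⟨r, hr_def⟩ : ∃ r : ℝ, r = 1 / 4 := ⟨_, rfl⟩
  have hr : (0 : ℝ) < r := by rw [hr_def]; norm_num
  have hr2 : r ≤ 1 / 2 := by rw [hr_def]; norm_num
  obtain ⟨K, hK⟩ : ∃ K : ℝ, K = ((0 + 1 : ℕ) : ℝ)⁻¹ * configEnergy z₀ := ⟨_, rfl⟩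
  have hmod1 : ∀ s ∈ Icc (0 : ℝ) 0, ∀ x : T3,
      ∫ y, cone r y x * (fun (_ : ℝ) (_ : T3) => (-2 : ℝ)) s y ≤ (fun (_ : ℝ) (_ : T3) => (-2 : ℝ)) s x + 1 / 4 := by
    intro s _ x
    show ∫ y, cone r y x * (-2 : ℝ) ≤ -2 + 1 / 4
    rw [integral_mul_const, integral_cone_left hr hr2 x, one_mul]
    norm_num
  have hmod2 : ∀ s ∈ Icc (0 : ℝ) 0, ∀ s' ∈ Icc (0 : ℝ) 0, |s - s'| ≤ 1 →
      ∀ x x' : T3, Torus.euclidDist x x' ≤ 1 →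
        |(fun (_ : ℝ) (_ : T3) => (-2 : ℝ)) s x - (fun (_ : ℝ) (_ : T3) => (-2 : ℝ)) s' x'| ≤ 1 / 4 := by
    intro s _ s' _ _ x x' _
    norm_num
  have hδx2 : 3 / (Real.pi * r ^ 4) * 0 ≤ 1 / 8 := by norm_num
  have hSt : ∀ s ∈ ({0} : Finset ℝ), s ∈ Icc (0 : ℝ) 0 := by
    intro s hs
    rw [Finset.mem_singleton.1 hs]
    exact ⟨le_rfl, le_rfl⟩
  have hSt' : ∀ s ∈ Icc (0 : ℝ) 0, ∃ s' ∈ ({0} : Finset ℝ), |s - s'| ≤ 0 := by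
    intro s hs
    refine ⟨0, Finset.mem_singleton_self _, ?_⟩
    rw [le_antisymm hs.2 hs.1, sub_self, abs_zero]
  have hδt2 : 3 / (Real.pi * r ^ 4) * Real.sqrt (2 * K) * 0 ≤ 1 / 8 := by norm_num
  have key := h _ _ (Φ 0) (fun _ _ => -2) 0 1 r 1 1 K 0 0 hr (hclock_holds (Φ 0) hr)
    (mollDensity_lipschitz_centre hr) hmod1 hmod2 ∅ zero_le_one hδx2 {0} hSt hSt' zero_le_one hδt2
  have hz₀mem : z₀ ∈ {z | ∃ s ∈ Icc (0 : ℝ) 0, ∃ x : T3,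
      (fun (_ : ℝ) (_ : T3) => (-2 : ℝ)) s x + 1 < mollDensity r ((Φ 0).flow s z) x} ∩
      (Φ 0).good ∩ {z | ((0 + 1 : ℕ) : ℝ)⁻¹ * configEnergy z ≤ K} := by
    refine ⟨⟨⟨0, ⟨le_rfl, le_rfl⟩, 0, ?_⟩, hz₀⟩, ?_⟩
    · show (-2 : ℝ) + 1 < mollDensity r ((Φ 0).flow 0 z₀) 0
      have := mollDensity_nonneg hr ((Φ 0).flow 0 z₀) 0
      linarith
    · show ((0 + 1 : ℕ) : ℝ)⁻¹ * configEnergy z₀ ≤ K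
      rw [hK]
  have hz₀in := key hz₀mem
  simp only [Set.mem_iUnion, exists_prop, Finset.notMem_empty, false_and, exists_false, and_false] at hz₀in

/-! ## §4 STUB E without `hmod` (the density-modulus package) is FALSE -/

/-- STUB E `stub_gridUpgrade` with the hypothesis `hmod` DROPPED (all else verbatim, `K` free). -/
def GridUpgradeWithoutMod : Prop :=
  ∀ (σ : ℝ) (a₀ θ₀ : T3 → ℝ) (u₀ : T3 → V3) (Φ : Flows σ) (ρ : ℝ → T3 → ℝ) (t : ℝ), 0 ≤ t →
    (∀ N : ℕ, ∀ z ∈ (Φ N).good, ∀ s s' : ℝ,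
      ((N + 1 : ℕ) : ℝ)⁻¹ * ∑ i, Torus.euclidDist (((Φ N).flow s' z i).1) (((Φ N).flow s z i).1) ≤
        Real.sqrt (2 * (((N + 1 : ℕ) : ℝ)⁻¹ * configEnergy z)) * |s' - s|) →
    ∀ K : ℝ, Tendsto (fun N => localGibbsLaw σ a₀ u₀ θ₀ N (Φ N)
      {z | K < ((N + 1 : ℕ) : ℝ)⁻¹ * configEnergy z}) atTop (𝓝 0) →
    (∀ s ∈ Icc 0 t, ∀ χ : T3 → ℝ, Continuous χ → ∀ δ : ℝ, 0 < δ →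
      Tendsto (fun N => localGibbsLaw σ a₀ u₀ θ₀ N (Φ N)
        {z | δ < |empiricalDensityField ((Φ N).flow s z) χ - ∫ x, χ x * ρ s x|}) atTop (𝓝 0)) →
    CapLimit σ a₀ u₀ θ₀ Φ ρ t

/-- Points of `𝕋³` are Haar-null, so puncturing a field at one point does not change its integrals against tests. -/
theorem integral_mul_punctured (χ : T3 → ℝ) (c a : ℝ) (x₀ : T3) :
    ∫ x, χ x * (fun x : T3 => if x = x₀ then a else c) x = ∫ x, χ x * c := by
  haveI := Literature.Analysis.FluidPDE.nullSingletonClass_volume_unitAddTorus (Fin 3)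
  refine integral_congr_ae ?_
  have hnull : (volume : Measure T3) {x₀} = 0 := measure_singleton x₀
  have hae : ∀ᵐ x ∂(volume : Measure T3), x ≠ x₀ := by
    rw [ae_iff]
    simpa only [ne_eq, not_not, Set.setOf_eq_eq_singleton] using hnull
  filter_upwards [hae] with x hx
  simp [hx]

/-- **STUB E without `hmod` is FALSE** (so some regularity of `ρ` beyond what the fixed-time LLN identifies is
load-bearing): witness = the setting of `exists_setting` (homogeneous data, tied at `t = 0`; energy tightness from
the tie; displacement bound = landed STUB A), `t = 0`, and the PUNCTURED field `ρ(s, x) = 1` for `x ≠ 0`,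
`ρ(s, 0) = −3`. The density LLN at `s = 0` holds for `ρ` because it holds for the constant field `1` and
`∫ χ ρ(0) = ∫ χ` (`integral_mul_punctured`); but with `η = 1`, `δ = 1/2` every configuration overshoots at
`(0, 0)` (`ρ̄ʳ ≥ 0 > −3 + 1`): the overshoot event is everything, of probability `1 > 1/2` at every `N`. -/
theorem not_gridUpgrade_without_hmod : ¬ GridUpgradeWithoutMod := by
  intro h
  obtain ⟨σ, _hσ, Φ, hP, h0⟩ := exists_setting
  obtain ⟨ρ, hρ⟩ : ∃ ρ : ℝ → T3 → ℝ, ρ = fun _ x => if x = 0 then -3 else 1 := ⟨_, rfl⟩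
  have hρ0 : ∀ s : ℝ, ρ s 0 = -3 := fun s => by rw [hρ]; simp
  have hdisp : ∀ N : ℕ, ∀ z ∈ (Φ N).good, ∀ s s' : ℝ,
      ((N + 1 : ℕ) : ℝ)⁻¹ * ∑ i, Torus.euclidDist (((Φ N).flow s' z i).1) (((Φ N).flow s z i).1) ≤
        Real.sqrt (2 * (((N + 1 : ℕ) : ℝ)⁻¹ * configEnergy z)) * |s' - s| :=
    fun N z hz s s' => stub_meanDisplacement (Φ N) hz s s'
  have hK := energyTight_of_tie Φ h0
  have hlln : ∀ s ∈ Icc (0 : ℝ) 0, ∀ χ : T3 → ℝ, Continuous χ → ∀ δ : ℝ, 0 < δ →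
      Tendsto (fun N => localGibbsLaw σ (fun _ => 1) (fun _ => 0) (fun _ => 1) N (Φ N)
        {z | δ < |empiricalDensityField ((Φ N).flow s z) χ - ∫ x, χ x * ρ s x|}) atTop (𝓝 0) := by
    intro s hs χ hχ δ hδ
    have hs0 : s = 0 := le_antisymm hs.2 hs.1
    have hint : ∫ x, χ x * ρ s x = ∫ x, χ x * (1 : ℝ) := by
      rw [hρ]
      exact integral_mul_punctured χ 1 (-3) 0
    rw [hint, hs0]
    exact (h0 χ hχ δ hδ).1
  have hcap := h σ (fun _ => 1) (fun _ => 1) (fun _ => 0) Φ ρ 0 le_rfl hdisp _ hK hlln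
  obtain ⟨r₀, hr₀, hr⟩ := hcap 1 (1 / 2) one_pos (by norm_num)
  have hrpos : 0 < min (r₀ / 2) (1 / 4) := lt_min (by positivity) (by norm_num)
  have hrlt : min (r₀ / 2) (1 / 4) < r₀ := lt_of_le_of_lt (min_le_left _ _) (by linarith)
  obtain ⟨N₀, hN⟩ := hr (min (r₀ / 2) (1 / 4)) hrpos hrlt
  have hle := hN N₀ le_rfl
  have huniv : capEvent Φ N₀ ρ 0 1 (min (r₀ / 2) (1 / 4)) = Set.univ := by
    refine Set.eq_univ_of_forall fun z => ⟨0, ⟨le_rfl, le_rfl⟩, 0, ?_⟩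
    have h0le := mollDensity_nonneg hrpos ((Φ N₀).flow 0 z) 0
    show ρ 0 0 + 1 < mollDensity (min (r₀ / 2) (1 / 4)) ((Φ N₀).flow 0 z) 0
    rw [hρ0]
    linarith
  rw [huniv] at hle
  haveI := hP N₀
  rw [measure_univ] at hle
  have hlt : ENNReal.ofReal (1 / 2 : ℝ) < 1 := by
    rw [← ENNReal.ofReal_one]
    exact (ENNReal.ofReal_lt_ofReal_iff one_pos).2 (by norm_num)
  exact absurd hle (not_le.2 hlt)

/-! ## §5 POSITIVE (for re-users of E): the cap from the SUB-MEAN-VALUE half (i) of `hmod` alone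

Not a stub of the skeleton — a strengthening of STUB E recorded as information (a refuter lands only `¬`-theorems;
this rides as item evidence). The joint continuity modulus (ii) of `ρ` is NOT needed: the fixed-time LLN at two
space-time points plus the SURE clock / centre-Lipschitz bounds, sandwiched through one good configuration of a
high-probability intersection, make the mollified Euler field `(s,x) ↦ ∫ cone r y x ρ(s,y) dy` Lipschitz on
`[0,t] × 𝕋³` with the clock's constants (`hboot` below); D's bookkeeping then runs on `∫ cone·ρ` instead of `ρ`.
No `ht`, no `hdisp` (landed A), no `r₀ ≤ 1/2`, and the laws may even be junk (zero / infinite mass). -/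

/-- The cone kernel is continuous in the particle slot. -/
theorem continuous_cone_left (r : ℝ) (x : T3) : Continuous fun y : T3 => cone r y x := by
  unfold cone
  simp only [Torus.euclidDist_eq]
  refine continuous_const.mul ((continuous_const.sub ?_).max continuous_const)
  exact (Torus.continuous_norm_reprSym.comp (continuous_id.sub continuous_const)).div_const r

/-- Finite nets of `[0, t]` inside `[0, t]` at every mesh (gen-1, copied). -/
theorem exists_time_net {t δ : ℝ} (ht : 0 ≤ t) (hδ : 0 < δ) :
    ∃ St : Finset ℝ, (∀ s ∈ St, s ∈ Icc 0 t) ∧ ∀ s ∈ Icc 0 t, ∃ s' ∈ St, |s - s'| ≤ δ := by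
  obtain ⟨M, hM⟩ := exists_nat_gt (t / δ)
  have hMpos : (0 : ℝ) < M := lt_of_le_of_lt (div_nonneg ht hδ.le) hM
  have hstep : t / M ≤ δ := by
    rw [div_le_iff₀ hMpos]
    have := (div_lt_iff₀ hδ).1 hM
    linarith
  refine ⟨(Finset.range (M + 1)).image fun k : ℕ => (k : ℝ) * (t / M), ?_, ?_⟩
  · intro s hs
    obtain ⟨k, hk, rfl⟩ := Finset.mem_image.1 hs
    have hkM : (k : ℝ) ≤ M := by exact_mod_cast Nat.lt_succ_iff.1 (Finset.mem_range.1 hk)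
    refine ⟨by positivity, ?_⟩
    calc (k : ℝ) * (t / M) ≤ M * (t / M) := by gcongr
      _ = t := by field_simp
  · intro s hs
    rcases eq_or_lt_of_le ht with rfl | htpos
    · refine ⟨0, Finset.mem_image.2 ⟨0, by simp, by simp⟩, ?_⟩
      have : s = 0 := le_antisymm hs.2 hs.1
      simp [this, hδ.le]
    · have hh : 0 < t / M := div_pos htpos hMpos
      set k := ⌊s / (t / M)⌋₊ with hk
      have hks : (k : ℝ) * (t / M) ≤ s := by
        have := Nat.floor_le (div_nonneg hs.1 hh.le)
        rw [← hk] at this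
        calc (k : ℝ) * (t / M) ≤ s / (t / M) * (t / M) := by gcongr
          _ = s := by field_simp
      have hsk : s < ((k : ℝ) + 1) * (t / M) := by
        have := Nat.lt_floor_add_one (s / (t / M))
        rw [← hk] at this
        calc s = s / (t / M) * (t / M) := by field_simp
          _ < ((k : ℝ) + 1) * (t / M) := by gcongr
      have hkM : k ≤ M := by
        have h1 : (k : ℝ) * (t / M) ≤ t := hks.trans hs.2
        have h2 : (k : ℝ) ≤ M := by
          by_contra hlt
          rw [not_le] at hlt
          have : (M : ℝ) * (t / M) < k * (t / M) := by gcongr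
          rw [show (M : ℝ) * (t / M) = t by field_simp] at this
          linarith
        exact_mod_cast h2
      refine ⟨(k : ℝ) * (t / M), Finset.mem_image.2 ⟨k, Finset.mem_range.2 (Nat.lt_succ_of_le hkM), rfl⟩, ?_⟩
      rw [abs_of_nonneg (by linarith)]
      calc s - k * (t / M) ≤ t / M := by nlinarith
        _ ≤ δ := hstep

/-- For `t < 0` the overshoot event is empty, so `CapLimit … t` holds trivially (gen-3, copied). -/
theorem capLimit_of_neg (σ : ℝ) (a₀ θ₀ : T3 → ℝ) (u₀ : T3 → V3) (Φ : Flows σ) (ρ : ℝ → T3 → ℝ) {t : ℝ}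
    (ht : t < 0) : CapLimit σ a₀ u₀ θ₀ Φ ρ t := by
  intro η δ _ _
  refine ⟨1, one_pos, fun r _ _ => ⟨0, fun N _ => ?_⟩⟩
  have hempty : capEvent Φ N ρ t η r = ∅ := by
    refine Set.eq_empty_of_forall_notMem fun z hz => ?_
    obtain ⟨s, hs, -⟩ := hz
    exact absurd (hs.1.trans hs.2) (not_le.2 ht)
  rw [hempty, measure_empty]
  exact zero_le

/-- If the total masses of the laws tend to zero, `CapLimit` is trivial. -/
theorem capLimit_of_mass_tendsto_zero (σ : ℝ) (a₀ θ₀ : T3 → ℝ) (u₀ : T3 → V3) (Φ : Flows σ) (ρ : ℝ → T3 → ℝ)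
    (t : ℝ) (hmass : Tendsto (fun N => localGibbsLaw σ a₀ u₀ θ₀ N (Φ N) Set.univ) atTop (𝓝 0)) :
    CapLimit σ a₀ u₀ θ₀ Φ ρ t := by
  intro η δ _ hδ
  refine ⟨1, one_pos, fun r _ _ => ?_⟩
  have hδ' : (0 : ℝ≥0∞) < ENNReal.ofReal δ := ENNReal.ofReal_pos.2 hδ
  obtain ⟨N₀, hN₀⟩ := eventually_atTop.1 (hmass.eventually (Iio_mem_nhds hδ'))
  exact ⟨N₀, fun N hN => (measure_mono (Set.subset_univ _)).trans (le_of_lt (hN₀ N hN))⟩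

/-- **STUB E from the sub-mean-value half (i) of `hmod` alone** (no joint modulus (ii), no `ht`, no `hdisp`):
energy tightness + (i) at small scales + the fixed-time density LLN on `[0, t]` ⇒ the cap. -/
theorem gridUpgrade_of_submean {σ : ℝ} (a₀ θ₀ : T3 → ℝ) (u₀ : T3 → V3) (Φ : Flows σ) (ρ : ℝ → T3 → ℝ)
    {t K : ℝ}
    (hK : Tendsto (fun N => localGibbsLaw σ a₀ u₀ θ₀ N (Φ N)
      {z | K < ((N + 1 : ℕ) : ℝ)⁻¹ * configEnergy z}) atTop (𝓝 0))
    (hsub : ∀ η : ℝ, 0 < η → ∃ r₀ : ℝ, 0 < r₀ ∧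
      ∀ r : ℝ, 0 < r → r < r₀ → ∀ s ∈ Icc 0 t, ∀ x : T3, ∫ y, cone r y x * ρ s y ≤ ρ s x + η)
    (hlln : ∀ s ∈ Icc 0 t, ∀ χ : T3 → ℝ, Continuous χ → ∀ δ : ℝ, 0 < δ →
      Tendsto (fun N => localGibbsLaw σ a₀ u₀ θ₀ N (Φ N)
        {z | δ < |empiricalDensityField ((Φ N).flow s z) χ - ∫ x, χ x * ρ s x|}) atTop (𝓝 0)) :
    CapLimit σ a₀ u₀ θ₀ Φ ρ t := by
  rcases lt_or_ge t 0 with ht | ht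
  · exact capLimit_of_neg σ a₀ θ₀ u₀ Φ ρ ht
  set P : (N : ℕ) → Measure (Config (N + 1) (Fin 3) T3) := fun N => localGibbsLaw σ a₀ u₀ θ₀ N (Φ N) with hP
  by_cases hmass : Tendsto (fun N => P N Set.univ) atTop (𝓝 0)
  · exact capLimit_of_mass_tendsto_zero σ a₀ θ₀ u₀ Φ ρ t hmass
  -- a positive mass `m₀` seen infinitely often
  obtain ⟨m₀, hm₀, hfreq⟩ : ∃ m₀ : ℝ≥0∞, 0 < m₀ ∧ ∃ᶠ N in atTop, m₀ ≤ P N Set.univ := by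
    by_contra hcon
    apply hmass
    rw [ENNReal.nhds_zero_basis.tendsto_right_iff]
    intro m₀ hm₀
    by_contra hev
    exact hcon ⟨m₀, hm₀, (Filter.not_eventually.1 hev).mono fun N hN => not_lt.1 hN⟩
  intro η δ hη hδ
  obtain ⟨r₀, hr₀, hsub1⟩ := hsub (η / 4) (by positivity)
  refine ⟨r₀, hr₀, fun r hr hrr₀ => ?_⟩
  -- constants and nets
  set L : ℝ := 3 / (Real.pi * r ^ 4) with hL
  have hLpos : 0 < L := by positivity
  set δx : ℝ := η / 16 / L with hδx
  have hδxpos : 0 < δx := by positivity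
  set δt : ℝ := η / 16 / (L * (Real.sqrt (2 * K) + 1)) with hδt
  have hsq1 : 0 < Real.sqrt (2 * K) + 1 := by positivity
  have hδtpos : 0 < δt := by positivity
  obtain ⟨Sx, hSx⟩ := exists_euclidDist_net hδxpos
  obtain ⟨St, hSt, hSt'⟩ := exists_time_net ht hδtpos
  have hδx₂ : L * δx = η / 16 := by
    rw [hδx]
    field_simp
  have hδt₂ : L * Real.sqrt (2 * K) * δt ≤ η / 16 := by
    calc L * Real.sqrt (2 * K) * δt ≤ L * (Real.sqrt (2 * K) + 1) * δt := by
          gcongr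
          linarith
      _ = η / 16 := by
          rw [hδt]
          field_simp
  -- the mollified Euler field
  obtain ⟨I, hI⟩ : ∃ I : ℝ → T3 → ℝ, I = fun s x => ∫ y, cone r y x * ρ s y := ⟨_, rfl⟩
  -- SANDWICH: two LLN events, energy, good set — a common good configuration exists at some `N`
  have hsand : ∀ s ∈ Icc 0 t, ∀ s' ∈ Icc 0 t, ∀ (x x' : T3) (ε : ℝ), 0 < ε →
      ∃ N : ℕ, ∃ z ∈ (Φ N).good, ((N + 1 : ℕ) : ℝ)⁻¹ * configEnergy z ≤ K ∧
        |mollDensity r ((Φ N).flow s z) x - I s x| ≤ ε ∧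
        |mollDensity r ((Φ N).flow s' z) x' - I s' x'| ≤ ε := by
    intro s hs s' hs' x x' ε hε
    have hA := hlln s hs (fun y => cone r y x) (continuous_cone_left r x) ε hε
    have hB := hlln s' hs' (fun y => cone r y x') (continuous_cone_left r x') ε hε
    have hsum3 : Tendsto (fun N =>
        P N {z | ε < |empiricalDensityField ((Φ N).flow s z) (fun y => cone r y x) - ∫ y, cone r y x * ρ s y|} +
        P N {z | ε < |empiricalDensityField ((Φ N).flow s' z) (fun y => cone r y x') - ∫ y, cone r y x' * ρ s' y|} +
        P N {z | K < ((N + 1 : ℕ) : ℝ)⁻¹ * configEnergy z}) atTop (𝓝 0) := by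
      simpa using (hA.add hB).add hK
    have hev : ∀ᶠ N in atTop,
        P N {z | ε < |empiricalDensityField ((Φ N).flow s z) (fun y => cone r y x) - ∫ y, cone r y x * ρ s y|} +
        P N {z | ε < |empiricalDensityField ((Φ N).flow s' z) (fun y => cone r y x') - ∫ y, cone r y x' * ρ s' y|} +
        P N {z | K < ((N + 1 : ℕ) : ℝ)⁻¹ * configEnergy z} < m₀ :=
      hsum3.eventually (Iio_mem_nhds hm₀)
    obtain ⟨N, hN1, hN2⟩ := (hfreq.and_eventually hev).exists
    by_contra hnone
    push Not at hnone
    -- every configuration misses one of the four requirements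
    have hcover : (Set.univ : Set (Config (N + 1) (Fin 3) T3)) ⊆
        (({z | ε < |empiricalDensityField ((Φ N).flow s z) (fun y => cone r y x) - ∫ y, cone r y x * ρ s y|} ∪
          {z | ε < |empiricalDensityField ((Φ N).flow s' z) (fun y => cone r y x') - ∫ y, cone r y x' * ρ s' y|}) ∪
          {z | K < ((N + 1 : ℕ) : ℝ)⁻¹ * configEnergy z}) ∪ (Φ N).goodᶜ := by
      intro z _
      by_cases hg : z ∈ (Φ N).good
      · by_cases hKz : ((N + 1 : ℕ) : ℝ)⁻¹ * configEnergy z ≤ K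
        · by_cases ha : |mollDensity r ((Φ N).flow s z) x - I s x| ≤ ε
          · have hb := hnone N z hg hKz ha
            refine Or.inl (Or.inl (Or.inr ?_))
            show ε < |mollDensity r ((Φ N).flow s' z) x' - ∫ y, cone r y x' * ρ s' y|
            have : I s' x' = ∫ y, cone r y x' * ρ s' y := by rw [hI]
            rw [← this]
            exact hb
          · refine Or.inl (Or.inl (Or.inl ?_))
            show ε < |mollDensity r ((Φ N).flow s z) x - ∫ y, cone r y x * ρ s y|
            have : I s x = ∫ y, cone r y x * ρ s y := by rw [hI]
            rw [← this]
            exact not_le.1 ha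
        · exact Or.inl (Or.inr (not_le.1 hKz))
      · exact Or.inr hg
    have hle : P N Set.univ ≤
        P N {z | ε < |empiricalDensityField ((Φ N).flow s z) (fun y => cone r y x) - ∫ y, cone r y x * ρ s y|} +
        P N {z | ε < |empiricalDensityField ((Φ N).flow s' z) (fun y => cone r y x') - ∫ y, cone r y x' * ρ s' y|} +
        P N {z | K < ((N + 1 : ℕ) : ℝ)⁻¹ * configEnergy z} := by
      calc P N Set.univ ≤ P N ((({z | ε < |empiricalDensityField ((Φ N).flow s z) (fun y => cone r y x) -
              ∫ y, cone r y x * ρ s y|} ∪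
            {z | ε < |empiricalDensityField ((Φ N).flow s' z) (fun y => cone r y x') - ∫ y, cone r y x' * ρ s' y|}) ∪
            {z | K < ((N + 1 : ℕ) : ℝ)⁻¹ * configEnergy z}) ∪ (Φ N).goodᶜ) := measure_mono hcover
        _ ≤ P N (({z | ε < |empiricalDensityField ((Φ N).flow s z) (fun y => cone r y x) - ∫ y, cone r y x * ρ s y|} ∪
            {z | ε < |empiricalDensityField ((Φ N).flow s' z) (fun y => cone r y x') - ∫ y, cone r y x' * ρ s' y|}) ∪
            {z | K < ((N + 1 : ℕ) : ℝ)⁻¹ * configEnergy z}) + P N (Φ N).goodᶜ := measure_union_le _ _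
        _ ≤ (P N ({z | ε < |empiricalDensityField ((Φ N).flow s z) (fun y => cone r y x) - ∫ y, cone r y x * ρ s y|} ∪
            {z | ε < |empiricalDensityField ((Φ N).flow s' z) (fun y => cone r y x') - ∫ y, cone r y x' * ρ s' y|}) +
            P N {z | K < ((N + 1 : ℕ) : ℝ)⁻¹ * configEnergy z}) + 0 :=
            add_le_add (measure_union_le _ _) (le_of_eq (localGibbsLaw_compl_good σ a₀ θ₀ u₀ N (Φ N)))
        _ ≤ (P N {z | ε < |empiricalDensityField ((Φ N).flow s z) (fun y => cone r y x) - ∫ y, cone r y x * ρ s y|} +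
            P N {z | ε < |empiricalDensityField ((Φ N).flow s' z) (fun y => cone r y x') - ∫ y, cone r y x' * ρ s' y|} +
            P N {z | K < ((N + 1 : ℕ) : ℝ)⁻¹ * configEnergy z}) + 0 := by
            gcongr
            exact measure_union_le _ _
        _ = _ := add_zero _
    exact absurd (hN1.trans hle) (not_le.2 hN2)
  -- BOOTSTRAP: the mollified Euler field is Lipschitz on the slab with the clock's constants
  have hboot : ∀ s ∈ Icc 0 t, ∀ s' ∈ Icc 0 t, ∀ x x' : T3,
      |I s x - I s' x'| ≤ L * Real.sqrt (2 * K) * |s' - s| + L * Torus.euclidDist x x' := by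
    intro s hs s' hs' x x'
    refine le_of_forall_pos_le_add fun ε hε => ?_
    obtain ⟨N, z, hz, hKz, h1, h2⟩ := hsand s hs s' hs' x x' (ε / 2) (by positivity)
    have hc : |mollDensity r ((Φ N).flow s' z) x - mollDensity r ((Φ N).flow s z) x| ≤
        L * Real.sqrt (2 * K) * |s' - s| := by
      refine (hclock_holds (Φ N) hr z hz s s' x).trans ?_
      have hsqrt : Real.sqrt (2 * (((N + 1 : ℕ) : ℝ)⁻¹ * configEnergy z)) ≤ Real.sqrt (2 * K) :=
        Real.sqrt_le_sqrt (by linarith)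
      have hLnn : 0 ≤ 3 / (Real.pi * r ^ 4) := hLpos.le
      exact mul_le_mul_of_nonneg_right (mul_le_mul_of_nonneg_left hsqrt hLnn) (abs_nonneg _)
    have hl : |mollDensity r ((Φ N).flow s' z) x - mollDensity r ((Φ N).flow s' z) x'| ≤
        L * Torus.euclidDist x x' := mollDensity_lipschitz_centre hr _ x x'
    rw [abs_le] at h1 h2 hc hl ⊢
    constructor <;> linarith [h1.1, h1.2, h2.1, h2.2, hc.1, hc.2, hl.1, hl.2]
  -- the grid events
  set G : (N : ℕ) → ℝ → T3 → Set (Config (N + 1) (Fin 3) T3) := fun N s x =>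
    {z | η / 4 < |empiricalDensityField ((Φ N).flow s z) (fun y => cone r y x) - ∫ y, cone r y x * ρ s y|}
    with hG
  -- the SURE inclusion at every `N` (D's bookkeeping, with `hboot` in place of the modulus (ii))
  have hincl : ∀ N : ℕ, capEvent Φ N ρ t η r ⊆
      ((Φ N).goodᶜ ∪ {z | K < ((N + 1 : ℕ) : ℝ)⁻¹ * configEnergy z}) ∪ ⋃ s ∈ St, ⋃ x ∈ Sx, G N s x := by
    intro N z hz
    by_cases hg : z ∈ (Φ N).good
    · by_cases hKz : ((N + 1 : ℕ) : ℝ)⁻¹ * configEnergy z ≤ K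
      · right
        obtain ⟨s, hs, x, hx⟩ := hz
        obtain ⟨sk, hsk, hssk⟩ := hSt' s hs
        obtain ⟨xl, hxl, hxxl⟩ := hSx x
        simp only [Set.mem_iUnion, exists_prop]
        refine ⟨sk, hsk, xl, hxl, ?_⟩
        have hc0 : 0 ≤ 3 / (Real.pi * r ^ 4) := hLpos.le
        have h1 : |mollDensity r ((Φ N).flow sk z) x - mollDensity r ((Φ N).flow s z) x| ≤ η / 16 := by
          refine (hclock_holds (Φ N) hr z hg s sk x).trans ?_
          have hsqrt : Real.sqrt (2 * (((N + 1 : ℕ) : ℝ)⁻¹ * configEnergy z)) ≤ Real.sqrt (2 * K) :=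
            Real.sqrt_le_sqrt (by linarith)
          have habs : |sk - s| ≤ δt := by rw [abs_sub_comm]; exact hssk
          calc 3 / (Real.pi * r ^ 4) * Real.sqrt (2 * (((N + 1 : ℕ) : ℝ)⁻¹ * configEnergy z)) * |sk - s|
              ≤ 3 / (Real.pi * r ^ 4) * Real.sqrt (2 * K) * δt :=
                mul_le_mul (mul_le_mul_of_nonneg_left hsqrt hc0) habs (abs_nonneg _)
                  (mul_nonneg hc0 (Real.sqrt_nonneg _))
            _ ≤ η / 16 := hδt₂
        have h2 : |mollDensity r ((Φ N).flow sk z) x - mollDensity r ((Φ N).flow sk z) xl| ≤ η / 16 := by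
          refine (mollDensity_lipschitz_centre hr _ x xl).trans ?_
          calc 3 / (Real.pi * r ^ 4) * Torus.euclidDist x xl ≤ 3 / (Real.pi * r ^ 4) * δx :=
                mul_le_mul_of_nonneg_left hxxl hc0
            _ = η / 16 := hδx₂
        have h3 : I s x ≤ ρ s x + η / 4 := by
          have := hsub1 r hr hrr₀ s hs x
          rw [hI]
          exact this
        have h4 : |I s x - I sk xl| ≤ η / 8 := by
          refine (hboot s hs sk (hSt sk hsk) x xl).trans ?_
          have habs : |sk - s| ≤ δt := by rw [abs_sub_comm]; exact hssk
          have e1 : L * Real.sqrt (2 * K) * |sk - s| ≤ η / 16 :=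
            (mul_le_mul_of_nonneg_left habs (by positivity)).trans hδt₂
          have e2 : L * Torus.euclidDist x xl ≤ η / 16 := by
            calc L * Torus.euclidDist x xl ≤ L * δx := mul_le_mul_of_nonneg_left hxxl hLpos.le
              _ = η / 16 := hδx₂
          linarith
        have hed : empiricalDensityField ((Φ N).flow sk z) (fun y => cone r y xl) =
            mollDensity r ((Φ N).flow sk z) xl := rfl
        have hIk : ∫ y, cone r y xl * ρ sk y = I sk xl := by rw [hI]
        show η / 4 < |empiricalDensityField ((Φ N).flow sk z) (fun y => cone r y xl) - ∫ y, cone r y xl * ρ sk y|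
        rw [hed, hIk]
        have hx' : ρ s x + η < mollDensity r ((Φ N).flow s z) x := hx
        rw [abs_le] at h1 h2 h4
        refine lt_of_lt_of_le ?_ (le_abs_self _)
        linarith [h1.1, h1.2, h2.1, h2.2, h4.1, h4.2]
      · exact Or.inl (Or.inr (not_le.1 hKz))
    · exact Or.inl (Or.inl hg)
  -- union bound on the outer measure
  have hbound : ∀ N : ℕ, P N (capEvent Φ N ρ t η r) ≤
      P N {z | K < ((N + 1 : ℕ) : ℝ)⁻¹ * configEnergy z} + ∑ s ∈ St, ∑ x ∈ Sx, P N (G N s x) := by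
    intro N
    calc P N (capEvent Φ N ρ t η r)
        ≤ P N (((Φ N).goodᶜ ∪ {z | K < ((N + 1 : ℕ) : ℝ)⁻¹ * configEnergy z}) ∪ ⋃ s ∈ St, ⋃ x ∈ Sx, G N s x) :=
          measure_mono (hincl N)
      _ ≤ P N ((Φ N).goodᶜ ∪ {z | K < ((N + 1 : ℕ) : ℝ)⁻¹ * configEnergy z}) +
            P N (⋃ s ∈ St, ⋃ x ∈ Sx, G N s x) := measure_union_le _ _
      _ ≤ (P N (Φ N).goodᶜ + P N {z | K < ((N + 1 : ℕ) : ℝ)⁻¹ * configEnergy z}) +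
            ∑ s ∈ St, P N (⋃ x ∈ Sx, G N s x) :=
          add_le_add (measure_union_le _ _) (measure_biUnion_finset_le St _)
      _ ≤ (0 + P N {z | K < ((N + 1 : ℕ) : ℝ)⁻¹ * configEnergy z}) + ∑ s ∈ St, ∑ x ∈ Sx, P N (G N s x) := by
          gcongr with s _
          · exact le_of_eq (localGibbsLaw_compl_good σ a₀ θ₀ u₀ N (Φ N))
          · exact measure_biUnion_finset_le Sx _
      _ = _ := by rw [zero_add]
  have hGlim : ∀ s ∈ St, ∀ x ∈ Sx, Tendsto (fun N => P N (G N s x)) atTop (𝓝 0) := by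
    intro s hs x _
    exact hlln s (hSt s hs) (fun y => cone r y x) (continuous_cone_left r x) (η / 4) (by positivity)
  have hsum : Tendsto (fun N => ∑ s ∈ St, ∑ x ∈ Sx, P N (G N s x)) atTop (𝓝 0) := by
    have h := tendsto_finsetSum St fun s hs => tendsto_finsetSum Sx fun x hx => hGlim s hs x hx
    simpa using h
  have htot : Tendsto (fun N => P N {z | K < ((N + 1 : ℕ) : ℝ)⁻¹ * configEnergy z} +
      ∑ s ∈ St, ∑ x ∈ Sx, P N (G N s x)) atTop (𝓝 0) := by
    simpa using hK.add hsum
  have hδ' : (0 : ℝ≥0∞) < ENNReal.ofReal δ := ENNReal.ofReal_pos.2 hδ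
  obtain ⟨N₀, hN₀⟩ := eventually_atTop.1 (htot.eventually (Iio_mem_nhds hδ'))
  exact ⟨N₀, fun N hN => (hbound N).trans (le_of_lt (hN₀ N hN))⟩

/-- Corollary: the registered STUB E with the modulus half (ii) of `hmod`, `ht`, `hdisp` and `r₀ ≤ 1/2` all DROPPED. -/
theorem gridUpgrade_min2 {σ : ℝ} (a₀ θ₀ : T3 → ℝ) (u₀ : T3 → V3) (Φ : Flows σ) (ρ : ℝ → T3 → ℝ) {t K : ℝ}
    (hK : Tendsto (fun N => localGibbsLaw σ a₀ u₀ θ₀ N (Φ N)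
      {z | K < ((N + 1 : ℕ) : ℝ)⁻¹ * configEnergy z}) atTop (𝓝 0))
    (hmod : ∀ η : ℝ, 0 < η → ∃ r₀ : ℝ, 0 < r₀ ∧ r₀ ≤ 1 / 2 ∧
      (∀ r : ℝ, 0 < r → r < r₀ → ∀ s ∈ Icc 0 t, ∀ x : T3, ∫ y, cone r y x * ρ s y ≤ ρ s x + η) ∧
      ∃ τ₀ : ℝ, 0 < τ₀ ∧ ∀ s ∈ Icc 0 t, ∀ s' ∈ Icc 0 t, |s - s'| ≤ τ₀ →
        ∀ x x' : T3, Torus.euclidDist x x' ≤ r₀ → |ρ s x - ρ s' x'| ≤ η)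
    (hlln : ∀ s ∈ Icc 0 t, ∀ χ : T3 → ℝ, Continuous χ → ∀ δ : ℝ, 0 < δ →
      Tendsto (fun N => localGibbsLaw σ a₀ u₀ θ₀ N (Φ N)
        {z | δ < |empiricalDensityField ((Φ N).flow s z) χ - ∫ x, χ x * ρ s x|}) atTop (𝓝 0)) :
    CapLimit σ a₀ u₀ θ₀ Φ ρ t :=
  gridUpgrade_of_submean a₀ θ₀ u₀ Φ ρ hK
    (fun η hη => by
      obtain ⟨r₀, hr₀, -, h1, -⟩ := hmod η hη
      exact ⟨r₀, hr₀, h1⟩)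
    hlln

/-- Remark (b) of the docblock, typed: a field constant in space — e.g. gen-3's blow-up `ρ(s,x) = (T − s)⁻¹`, for
which B's modulus (ii) FAILS on `[0, T]` — satisfies the sub-mean-value hypothesis (i) of `gridUpgrade_of_submean`
on every time interval, trivially (cone mass `1`). -/
theorem submean_of_xConst (c : ℝ → ℝ) (t : ℝ) :
    ∀ η : ℝ, 0 < η → ∃ r₀ : ℝ, 0 < r₀ ∧ ∀ r : ℝ, 0 < r → r < r₀ → ∀ s ∈ Icc 0 t, ∀ x : T3,
      ∫ y, cone r y x * (fun (s : ℝ) (_ : T3) => c s) s y ≤ (fun (s : ℝ) (_ : T3) => c s) s x + η := by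
  intro η hη
  refine ⟨1 / 2, by norm_num, fun r hr hr2 s _ x => ?_⟩
  show ∫ y, cone r y x * c s ≤ c s + η
  rw [integral_mul_const, integral_cone_left hr hr2.le x, one_mul]
  linarith

end DrefuteG4.Mutations

end
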